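import Literature.Probability.RandomPlanarGeometry.HexSAWSurfaceWallRenewalBlocks
import Literature.Probability.RandomPlanarGeometry.HexSAWSurfaceWallRenewalFloorSeventeen
import Literature.Probability.RandomPlanarGeometry.HexSAWSurfaceSixthOrderUpper
import Literature.Probability.RandomPlanarGeometry.HexSAWSurfaceFourthOrderExact
import Literature.Probability.RandomPlanarGeometry.HexSAWSurfaceSecondOrderSharp
import HarnessLib

/-!
# The sixth-order coefficient of `β(y)²` is exactly six:
# `y⁵ (β(y)² − y − 1/y − 1/y² − 2/y³ − 4/y⁴) → 6`

`β(y) = wallRate y` is the exponential growth rate of wall bridges of self-avoiding walks on the brick-wall (hexagonal) lattice along a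
zigzag wall with contact fugacity `y` (the Duminil-Copin–Smirnov surface; «WALL-BRIDGES»).  The tree knows the strong-adsorption
expansion `β(y)² = y + 1/y + 1/y² + 2/y³ + 4/y⁴ + O(y⁻⁵)` with the EXACT coefficients `1, 1, 2` («SECOND-ORDER-SHARP», «THIRD-ORDER»,
«FOURTH-ORDER-EXACT») and `4` («FIFTH-ORDER-UPPER»/«-LOWER»), and the one-sided sixth order `… + 6/y⁵ + 57395700/y⁶` (`y ≥ 36`,
«SIXTH-ORDER-UPPER», whose NOT CLAIMED list names the matching lower bound).  This module proves the MATCHING LOWER BOUND and hence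

  ★★★ `tendsto_pow_five_mul_wallRate_sq_sub : y⁵ (β(y)² − y − 1/y − 1/y² − 2/y³ − 4/y⁴) → 6` (`y → ∞`),

i.e. `β(y)² = y + 1/y + 1/y² + 2/y³ + 4/y⁴ + 6/y⁵ + o(y⁻⁵)` (`isLittleO_wallRate_sq_sub_sixth`, `eventually_sixth_order_window`).

METHOD (Kesten's renewal identity as a LOWER bound; no enumeration of long bridges, no polynomial window with a constant).  Positive wall
bridges factor uniquely into irreducible blocks, and for `y > μ⁴` the block laws `f_s(y) = Λ_{2s}(y)/β(y)^{2s}` sum to one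
(`hasSum_pwbLaw`, «WALL-RENEWAL»; [MadrasSlade1993, §4.2, (4.2.4), Theorem 4.2.2], [Kesten 1963, §4]).  Restricting the identity to the
classes `(s, v)` (`v` = surface visits) with `s − v ≤ 6` that the tree EXHIBITS — `(1,1)` the atom, `(3,1)`, `(4,1)`, `(5,1)×3`
(«EXCESS-LIMIT», «EIGHT-UNIQUE», «TEN-THREE»: `f₃ = y/β⁶`, `f₄ = y/β⁸`, `f₅ = 3y/β¹⁰`), `(6,2)` («FLOOR-SEVENTEEN»'s `qw`), and the
thirty-six table walks of «BLOCKS»: `(6,1)×6`, `(7,1)×15`, `(7,2)×3`, `(8,2)×11`, `(9,3)×1` — gives, with `B = β²` (§2),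

  `y/B + y/B³ + y/B⁴ + 3y/B⁵ + (6y + y²)/B⁶ + (15y + 3y²)/B⁷ + 11y²/B⁸ + y³/B⁹ ≤ 1`.

With `r = y/B` this is LINEAR in `B − y = y(1 − r)/r`, and multiplying by `y⁵B` yields the closed form (§3)

  `T(y) := y⁵(β² − y − 1/y − 1/y² − 2/y³ − 4/y⁴) ≥ G(y, r) := y⁴(r² − 1) + y³(r³ − 1) + y²(3r⁴ + r⁵ − 2) + y(6r⁵ + 3r⁶ − 4) + (15r⁶ + 11r⁷ + r⁸)`.

The apparent divergences `y⁴, y³, y²` of `G` cancel against the known lower orders: substituting `E = y²(1 − r)` and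
`F = y⁴(1 − r) − y² − y` turns `G` IDENTICALLY into a polynomial `Q(E, F, 1/y)` (§0, `ring`), and `E → 1`, `F → 1` follow from
`y(β² − y) → 1` («SECOND-ORDER-SHARP») and `y³(β² − y − 1/y − 1/y²) → 2` («FOURTH-ORDER-EXACT») by limit algebra; `Q(1, 1, 0) = 6`.  So
`liminf T ≥ 6` (§4, `tendsto_sixth_order_lower`), and «SIXTH-ORDER-UPPER»'s `T ≤ 6 + 57395700/y` closes the squeeze.  In the census
bookkeeping of the companions: `a₅ = N₇₁ + N₈₂ + N₉₃ − 21 = 15 + 11 + 1 − 21 = 6`.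

CONTENTS. §0 private plumbing (`μ⁴ ≥ 4`, `f_s = Λ_{2s}/B^s`, Kesten partial sums, `f₁ ≥ y/B`, the limits `y/B → 1`, `E → 1`, `F → 1`,
the polynomials `G`, `Q`, the substitution identity and `Q(E, F, 1/y) → 6`) · §1 ★ `six_mul_add_sq_le_IPWB_twelve : 6y + y² ≤ Λ₁₂(y)` ·
§2 ★★ `sixth_order_partial_sum_le_one` · §3 ★★ `sixth_order_lower` (the closed form) · §4 ★★ `tendsto_sixth_order_lower` (`G → 6`),
★★★ `tendsto_pow_five_mul_wallRate_sq_sub`, ★★★ `isLittleO_wallRate_sq_sub_sixth`, ★★ `eventually_sixth_order_window`.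

HONEST LABEL.  LANE THEOREM for this model; the printed sources carry the first-order statement `β ∼ √y` only
([BeatonBousquetMelouDeGierDuminilCopinGuttmann2014, §3.1, Proposition 5 and the remark on p. 10 (arXiv v5)]) and the general renewal
theory ([MadrasSlade1993, §4.2], [Kesten 1963, §4]); the coefficient `6` (like `1, 1, 2, 4` before it) is computed in this lane — NEW IN
WRITING (modest), not a quotation.  NOT CLAIMED: the seventh order (`a₆`; it would need the classes with `s − v = 7` and the counts
`N₆₁ = 6`, `N₇₂ = 3` as equalities), any rate in `o(y⁻⁵)` beyond the one-sided `O(y⁻⁶)` of «SIXTH-ORDER-UPPER», anything for `y ≤ μ⁴`,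
the armchair wall, numerics.
-/

namespace Literature.Probability.RandomPlanarGeometry.SAW.HexBW.Wall

open Finset Filter Function
open Literature.Probability.LatticeModels
open _root_.Topology Asymptotics

variable {y : ℝ} {n : ℕ} {ω : ℕ → Site 2}

/-! ### §0  Private plumbing -/

/-- `μ² = 2 + √2`. [cite: DuminilCopinSmirnov2012, Theorem 1] -/
private theorem mu_sq_sl : hexConnectiveConstant ^ 2 = 2 + Real.sqrt 2 := by
  rw [hexConnectiveConstant_eq_inv, inv_pow]; exact inv_eq_of_mul_eq_one_right hexCriticalFugacity_sq

/-- `4 ≤ μ⁴`. [cite: DuminilCopinSmirnov2012, Theorem 1] -/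
private theorem four_le_mu_four_sl : 4 ≤ hexConnectiveConstant ^ 4 := by
  have h2 : 0 ≤ Real.sqrt 2 := Real.sqrt_nonneg 2
  calc (4 : ℝ) ≤ (2 + Real.sqrt 2) ^ 2 := by nlinarith
    _ = hexConnectiveConstant ^ 4 := by rw [← mu_sq_sl]; ring

/-- `f_s(y) = Λ_{2s}(y)/(β(y)²)^s`. [cite: MadrasSlade1993, Section 4.2, (4.2.2) (p. 91)] -/
private theorem pwbLaw_eq_sl (y : ℝ) (s : ℕ) : pwbLaw y s = IPWB (2 * s) y / (wallRate y ^ 2) ^ s := by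
  rw [pwbLaw, pow_mul]

/-- A lower bound for `Λ_{2s}(y)` is a lower bound for `f_s(y)·(β²)^s`. [cite: MadrasSlade1993, Section 4.2, (4.2.2) (p. 91)] -/
private theorem div_le_pwbLaw_sl {s m : ℕ} (hm : m = 2 * s) {a : ℝ} (ha : a ≤ IPWB m y) : a / (wallRate y ^ 2) ^ s ≤ pwbLaw y s := by
  subst hm
  rw [pwbLaw_eq_sl]
  exact div_le_div_of_nonneg_right ha (pow_nonneg (sq_nonneg _) _)

/-- Kesten partial sums: `Σ_{s ∈ S} f_s(y) ≤ 1` for `y > μ⁴`. [cite: MadrasSlade1993, Section 4.2, (4.2.4) and Theorem 4.2.2 (pp. 91–92)] [cite: Kesten1963SAW, Section 4] -/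
private theorem sum_pwbLaw_le_one_sl (hy : hexConnectiveConstant ^ 4 < y) (S : Finset ℕ) : ∑ s ∈ S, pwbLaw y s ≤ 1 := by
  have hy0 : 0 ≤ y := by have := four_le_mu_four_sl; linarith
  exact sum_le_hasSum S (fun s _ => pwbLaw_nonneg hy0 s) (hasSum_pwbLaw hy)

/-- `f₁(y) ≥ y/β²` (the atom `(0,0) → (1,0) → (2,0)`; private twin, for `0 ≤ y`, of the tree's
`HexSAWSurfaceWallRenewalMean.div_sq_wallRate_le_pwbLaw_one`). [cite: MadrasSlade1993, Section 4.2, (4.2.2) (p. 91)] -/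
private theorem div_sq_wallRate_le_pwbLaw_one_sl (hy : 0 ≤ y) : y / wallRate y ^ 2 ≤ pwbLaw y 1 := by
  obtain ⟨m, hm⟩ : ∃ m : ℕ, m = 2 * 1 := ⟨_, rfl⟩
  have h := straightWalk_mem_pwb 1
  rw [← hm] at h
  have hmem : Zd.straightWalk 2 m ∈ ipwb m := by
    rw [mem_ipwb]
    refine ⟨h.1, by omega, fun k hk1 hk2 hr => ?_⟩
    have hk : k % 2 = 0 := hr.2.1
    omega
  have h1 : y ^ visits m (Zd.straightWalk 2 m) ≤ IPWB m y := Finset.single_le_sum (fun _ _ => pow_nonneg hy _) hmem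
  rw [h.2] at h1
  have h2 := div_le_pwbLaw_sl hm h1
  rwa [pow_one, pow_one] at h2

/-- `y/β² → 1` (`β ∼ √y`). [cite: BeatonBousquetMelouDeGierDuminilCopinGuttmann2014, Section 3.1, Proposition 5 (arXiv v5 p. 9)] -/
private theorem tendsto_div_sq_wallRate_sl : Tendsto (fun y : ℝ => y / wallRate y ^ 2) atTop (𝓝 1) := by
  have h1 : Tendsto (fun y : ℝ => ((wallRate y / Real.sqrt y) ^ 2)⁻¹) atTop (𝓝 ((1 : ℝ) ^ 2)⁻¹) :=
    (tendsto_wallRate_div_sqrt.pow 2).inv₀ (by norm_num)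
  rw [one_pow, inv_one] at h1
  refine h1.congr' ?_
  filter_upwards [eventually_gt_atTop (0 : ℝ)] with y hy
  rw [div_pow, Real.sq_sqrt hy.le, inv_div]

/-- `E(y) := y²(1 − y/β²) → 1` (`= y(β² − y) · y/β²`). [cite: BeatonBousquetMelouDeGierDuminilCopinGuttmann2014, Section 3.1, Proposition 5 (arXiv v5 p. 9)] -/
private theorem tendsto_E_sl : Tendsto (fun y : ℝ => y ^ 2 * (1 - y / wallRate y ^ 2)) atTop (𝓝 1) := by
  have h := tendsto_mul_wallRate_sq_sub.mul tendsto_div_sq_wallRate_sl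
  rw [one_mul] at h
  refine h.congr' ?_
  filter_upwards [eventually_gt_atTop (0 : ℝ)] with y hy
  have hB : wallRate y ≠ 0 := (wallRate_pos y).ne'
  field_simp

/-- `F(y) := y⁴(1 − y/β²) − y² − y → 1`, from the EXACT fourth order `y³(β² − y − 1/y − 1/y²) → 2` («FOURTH-ORDER-EXACT»):
`F = D₃ · (y/β²) − E − E/y` with `D₃ → 2`, `E → 1`. [cite: BeatonBousquetMelouDeGierDuminilCopinGuttmann2014, Section 3.1, Proposition 5 (arXiv v5 p. 9)] -/
private theorem tendsto_F_sl : Tendsto (fun y : ℝ => y ^ 4 * (1 - y / wallRate y ^ 2) - y ^ 2 - y) atTop (𝓝 1) := by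
  have h := ((tendsto_cube_mul_wallRate_sq_sub_sub.mul tendsto_div_sq_wallRate_sl).sub tendsto_E_sl).sub
    (tendsto_E_sl.div_atTop tendsto_id)
  rw [show (2 : ℝ) * 1 - 1 - 0 = 1 by norm_num] at h
  refine h.congr' ?_
  filter_upwards [eventually_gt_atTop (0 : ℝ)] with y hy
  have hB : wallRate y ≠ 0 := (wallRate_pos y).ne'
  have hy' : y ≠ 0 := hy.ne'
  simp only [id]
  field_simp
  ring

/-- The limit polynomial `Q(E, F, u)`: `G(y, 1 − ε) = Q(y²ε, y⁴ε − y² − y, 1/y)` identically, and `Q(1, 1, 0) = 6`.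
[cite: MadrasSlade1993, Section 4.2, (4.2.4) (p. 91)] -/
private def Q_sl (E F u : ℝ) : ℝ :=
  24 - 2 * F - 3 * F * u - 17 * E - 48 * E * u - 175 * E * u ^ 2 + E ^ 2 + 3 * E ^ 2 * u + 28 * E ^ 2 * u ^ 2 + 105 * E ^ 2 * u ^ 3 +
    484 * E ^ 2 * u ^ 4 - E ^ 3 * u ^ 3 - 22 * E ^ 3 * u ^ 4 - 120 * E ^ 3 * u ^ 5 - 741 * E ^ 3 * u ^ 6 + 8 * E ^ 4 * u ^ 6 +
    75 * E ^ 4 * u ^ 7 + 680 * E ^ 4 * u ^ 8 - E ^ 5 * u ^ 8 - 24 * E ^ 5 * u ^ 9 - 377 * E ^ 5 * u ^ 10 + 3 * E ^ 6 * u ^ 11 +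
    120 * E ^ 6 * u ^ 12 - 19 * E ^ 7 * u ^ 14 + E ^ 8 * u ^ 16

/-- The lower comparison function `G(y, r)` (`r = y/β²`). [cite: MadrasSlade1993, Section 4.2, (4.2.4) (p. 91)] -/
private def G_sl (y r : ℝ) : ℝ :=
  y ^ 4 * (r ^ 2 - 1) + y ^ 3 * (r ^ 3 - 1) + y ^ 2 * (3 * r ^ 4 + r ^ 5 - 2) + y * (6 * r ^ 5 + 3 * r ^ 6 - 4) +
    (15 * r ^ 6 + 11 * r ^ 7 + r ^ 8)

/-- The substitution identity `G(y, r) = Q(y²(1 − r), y⁴(1 − r) − y² − y, 1/y)` (`y ≠ 0`). [cite: MadrasSlade1993, Section 4.2, (4.2.4) (p. 91)] -/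
private theorem G_eq_Q_sl (hy : y ≠ 0) (r : ℝ) : G_sl y r = Q_sl (y ^ 2 * (1 - r)) (y ^ 4 * (1 - r) - y ^ 2 - y) (1 / y) := by
  unfold G_sl Q_sl
  field_simp
  ring

/-- `Q(E(y), F(y), 1/y) → Q(1, 1, 0) = 6`. [cite: BeatonBousquetMelouDeGierDuminilCopinGuttmann2014, Section 3.1, Proposition 5 (arXiv v5 p. 9)] -/
private theorem tendsto_Q_sl :
    Tendsto (fun y : ℝ => Q_sl (y ^ 2 * (1 - y / wallRate y ^ 2)) (y ^ 4 * (1 - y / wallRate y ^ 2) - y ^ 2 - y) (1 / y)) atTop (𝓝 6) := by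
  have hc : Continuous fun p : ℝ × ℝ × ℝ => Q_sl p.1 p.2.1 p.2.2 := by unfold Q_sl; fun_prop
  have hu : Tendsto (fun y : ℝ => 1 / y) atTop (𝓝 0) := tendsto_const_nhds.div_atTop tendsto_id
  have h3 := tendsto_E_sl.prodMk_nhds (tendsto_F_sl.prodMk_nhds hu)
  have h := (hc.tendsto ((1 : ℝ), (1 : ℝ), (0 : ℝ))).comp h3
  have h6 : Q_sl 1 1 0 = 6 := by norm_num [Q_sl]
  rw [h6] at h
  exact h

/-! ### §1  Length twelve: six one-visit blocks and the two-visit block `qw` give `6y + y² ≤ Λ₁₂(y)` -/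

/-- ★ `6·y + y² ≤ Λ₁₂(y)` (`y ≥ 0`, length symbolic): the six positive one-visit seeds of «BLOCKS» (`TwelveOne.W`) and the two-visit
block `Twelve.qw` of «FLOOR-SEVENTEEN» — two exhibited families with different visit numbers. [cite: Kesten1963SAW, Section 4] [cite: MadrasSlade1993, Section 4.2] -/
theorem six_mul_add_sq_le_IPWB_twelve {m : ℕ} (hm : m = 12) (hy : 0 ≤ y) : 6 * y + y ^ 2 ≤ IPWB m y := by
  have h := card_mul_pow_add_le_IPWB (W₂ := fun _ : Fin 1 => Twelve.qw) TwelveOne.W_injective (fun i j _ => Subsingleton.elim i j)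
    (TwelveOne.W_mem_ipwb hm) (fun _ => qw_mem_ipwb hm) (v₁ := 1) (v₂ := 2) (fun i => by rw [hm]; exact TwelveOne.visits_W i)
    (fun _ => by rw [hm]; exact Twelve.visits_qw) (by norm_num) hy
  simpa using h

/-! ### §2  Kesten's identity over the exhibited classes: the sixth-order partial sum is at most one -/

/-- ★★ **The sixth-order partial sum.**  For `y > μ⁴`, with `B = β(y)²`:
`y/B + y/B³ + y/B⁴ + 3y/B⁵ + (6y + y²)/B⁶ + (15y + 3y²)/B⁷ + 11y²/B⁸ + y³/B⁹ ≤ 1`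
— Kesten's identity `Σ_s f_s(y) = 1` restricted to `s ∈ {1,3,4,5,6,7,8,9}`, with `f₁ ≥ y/B`, `f₃ = y/B³`, `f₄ = y/B⁴`, `f₅ = 3y/B⁵`
(«TEN-THREE») and the exhibited lower bounds of §1 and «BLOCKS» for `f₆, f₇, f₈, f₉`. [cite: Kesten1963SAW, Section 4] [cite: MadrasSlade1993, Section 4.2, (4.2.4) and Theorem 4.2.2 (pp. 91–92)] -/
theorem sixth_order_partial_sum_le_one (hy : hexConnectiveConstant ^ 4 < y) :
    y / wallRate y ^ 2 + y / (wallRate y ^ 2) ^ 3 + y / (wallRate y ^ 2) ^ 4 + 3 * y / (wallRate y ^ 2) ^ 5 +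
      (6 * y + y ^ 2) / (wallRate y ^ 2) ^ 6 + (15 * y + 3 * y ^ 2) / (wallRate y ^ 2) ^ 7 + 11 * y ^ 2 / (wallRate y ^ 2) ^ 8 +
      y ^ 3 / (wallRate y ^ 2) ^ 9 ≤ 1 := by
  have hy0 : 0 ≤ y := by have := four_le_mu_four_sl; linarith
  have hS := sum_pwbLaw_le_one_sl hy {1, 3, 4, 5, 6, 7, 8, 9}
  rw [Finset.sum_insert (by decide), Finset.sum_insert (by decide), Finset.sum_insert (by decide), Finset.sum_insert (by decide),
    Finset.sum_insert (by decide), Finset.sum_insert (by decide), Finset.sum_insert (by decide), Finset.sum_singleton] at hS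
  have h1 := div_sq_wallRate_le_pwbLaw_one_sl hy0
  have h3 : pwbLaw y 3 = y / (wallRate y ^ 2) ^ 3 := by rw [pwbLaw_three, ← pow_mul]
  have h4 : pwbLaw y 4 = y / (wallRate y ^ 2) ^ 4 := by rw [pwbLaw_four_eq, ← pow_mul]
  have h5 : pwbLaw y 5 = 3 * y / (wallRate y ^ 2) ^ 5 := by rw [pwbLaw_five_eq, ← pow_mul]
  have h6 := div_le_pwbLaw_sl (s := 6) (m := 12) (by norm_num) (six_mul_add_sq_le_IPWB_twelve rfl hy0)
  have h7 := div_le_pwbLaw_sl (s := 7) (m := 14) (by norm_num) (fifteen_mul_add_three_sq_le_IPWB_fourteen rfl hy0)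
  have h8 := div_le_pwbLaw_sl (s := 8) (m := 16) (by norm_num) (eleven_sq_le_IPWB_sixteen rfl hy0)
  have h9 := div_le_pwbLaw_sl (s := 9) (m := 18) (by norm_num) (cube_le_IPWB_eighteen rfl hy0)
  linarith

/-! ### §3  The closed-form sixth-order lower bound -/

/-- ★★ **THE SIXTH-ORDER LOWER BOUND IN CLOSED FORM.**  For `y > μ⁴`, with `r = y/β(y)²`:
`y⁴(r² − 1) + y³(r³ − 1) + y²(3r⁴ + r⁵ − 2) + y(6r⁵ + 3r⁶ − 4) + (15r⁶ + 11r⁷ + r⁸) ≤ y⁵ (β(y)² − y − 1/y − 1/y² − 2/y³ − 4/y⁴)`.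
(The difference of the two sides is `y⁵ β² · (1 − partial sum) ≥ 0`.)  The left side tends to `6` (§4).
[cite: Kesten1963SAW, Section 4] [cite: MadrasSlade1993, Section 4.2, (4.2.4) (p. 91)] [cite: BeatonBousquetMelouDeGierDuminilCopinGuttmann2014, Section 3.1, Proposition 5 (arXiv v5 p. 9)] -/
theorem sixth_order_lower (hy : hexConnectiveConstant ^ 4 < y) :
    y ^ 4 * ((y / wallRate y ^ 2) ^ 2 - 1) + y ^ 3 * ((y / wallRate y ^ 2) ^ 3 - 1) +
        y ^ 2 * (3 * (y / wallRate y ^ 2) ^ 4 + (y / wallRate y ^ 2) ^ 5 - 2) +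
        y * (6 * (y / wallRate y ^ 2) ^ 5 + 3 * (y / wallRate y ^ 2) ^ 6 - 4) +
        (15 * (y / wallRate y ^ 2) ^ 6 + 11 * (y / wallRate y ^ 2) ^ 7 + (y / wallRate y ^ 2) ^ 8) ≤
      y ^ 5 * (wallRate y ^ 2 - y - 1 / y - 1 / y ^ 2 - 2 / y ^ 3 - 4 / y ^ 4) := by
  have hy0 : 0 < y := by have := four_le_mu_four_sl; linarith
  have hB : 0 < wallRate y ^ 2 := pow_pos (wallRate_pos y) 2
  have hK := sixth_order_partial_sum_le_one hy
  set B := wallRate y ^ 2 with hBdef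
  set K := y / B + y / B ^ 3 + y / B ^ 4 + 3 * y / B ^ 5 + (6 * y + y ^ 2) / B ^ 6 + (15 * y + 3 * y ^ 2) / B ^ 7 +
    11 * y ^ 2 / B ^ 8 + y ^ 3 / B ^ 9 with hKdef
  have key : y ^ 5 * (B - y - 1 / y - 1 / y ^ 2 - 2 / y ^ 3 - 4 / y ^ 4) -
      (y ^ 4 * ((y / B) ^ 2 - 1) + y ^ 3 * ((y / B) ^ 3 - 1) + y ^ 2 * (3 * (y / B) ^ 4 + (y / B) ^ 5 - 2) +
        y * (6 * (y / B) ^ 5 + 3 * (y / B) ^ 6 - 4) + (15 * (y / B) ^ 6 + 11 * (y / B) ^ 7 + (y / B) ^ 8)) =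
      y ^ 5 * B * (1 - K) := by
    rw [hKdef]
    field_simp
    ring
  have hpos : 0 ≤ y ^ 5 * B * (1 - K) := mul_nonneg (mul_nonneg (pow_nonneg hy0.le 5) hB.le) (sub_nonneg.2 hK)
  linarith

/-! ### §4  The limit: the sixth-order coefficient is exactly six -/

/-- ★★ The lower comparison function tends to six: with `r = y/β(y)²`,
`y⁴(r² − 1) + y³(r³ − 1) + y²(3r⁴ + r⁵ − 2) + y(6r⁵ + 3r⁶ − 4) + (15r⁶ + 11r⁷ + r⁸) → 6` — by the substitution
`G(y, r) = Q(E, F, 1/y)` with `E = y²(1 − r) → 1` and `F = y⁴(1 − r) − y² − y → 1` (fourth order EXACT).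
[cite: BeatonBousquetMelouDeGierDuminilCopinGuttmann2014, Section 3.1, Proposition 5 (arXiv v5 p. 9)] [cite: MadrasSlade1993, Section 4.2, (4.2.4) (p. 91)] -/
theorem tendsto_sixth_order_lower :
    Tendsto (fun y : ℝ => y ^ 4 * ((y / wallRate y ^ 2) ^ 2 - 1) + y ^ 3 * ((y / wallRate y ^ 2) ^ 3 - 1) +
        y ^ 2 * (3 * (y / wallRate y ^ 2) ^ 4 + (y / wallRate y ^ 2) ^ 5 - 2) +
        y * (6 * (y / wallRate y ^ 2) ^ 5 + 3 * (y / wallRate y ^ 2) ^ 6 - 4) +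
        (15 * (y / wallRate y ^ 2) ^ 6 + 11 * (y / wallRate y ^ 2) ^ 7 + (y / wallRate y ^ 2) ^ 8)) atTop (𝓝 6) := by
  refine tendsto_Q_sl.congr' ?_
  filter_upwards [eventually_gt_atTop (0 : ℝ)] with y hy
  have h := G_eq_Q_sl hy.ne' (y / wallRate y ^ 2)
  unfold G_sl at h
  exact h.symm

/-- ★★★ **THE SIXTH-ORDER COEFFICIENT OF `β(y)²` IS EXACTLY SIX:**
`y⁵ (β(y)² − y − 1/y − 1/y² − 2/y³ − 4/y⁴) → 6` as `y → ∞`, i.e.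
`β(y)² = y + 1/y + 1/y² + 2/y³ + 4/y⁴ + 6/y⁵ + o(y⁻⁵)` — the lower half by Kesten's identity over the thirty-six exhibited
irreducible positive wall bridges («BLOCKS», «FLOOR-SEVENTEEN», «TEN-THREE») and the exact fourth order, the upper half by
«SIXTH-ORDER-UPPER»'s `pow_five_mul_wallRate_sq_sub_le` (`≤ 6 + 57395700/y`, `y ≥ 36`).  In the census bookkeeping: `a₅ = N₇₁ + N₈₂ + N₉₃ − 21 = 15 + 11 + 1 − 21 = 6`.
[cite: BeatonBousquetMelouDeGierDuminilCopinGuttmann2014, Section 3.1, Proposition 5 (arXiv v5 p. 9); p. 10 (first-order remark)] [cite: Kesten1963SAW, Section 4] [cite: MadrasSlade1993, Section 4.2, Theorem 4.2.2 (pp. 91–92)] -/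
theorem tendsto_pow_five_mul_wallRate_sq_sub :
    Tendsto (fun y : ℝ => y ^ 5 * (wallRate y ^ 2 - y - 1 / y - 1 / y ^ 2 - 2 / y ^ 3 - 4 / y ^ 4)) atTop (𝓝 6) := by
  have hup : Tendsto (fun y : ℝ => 6 + 57395700 / y) atTop (𝓝 6) := by
    have h := (tendsto_const_nhds (x := (57395700 : ℝ))).div_atTop tendsto_id
    simpa using (tendsto_const_nhds (x := (6 : ℝ))).add h
  refine tendsto_of_tendsto_of_tendsto_of_le_of_le' tendsto_sixth_order_lower hup ?_ ?_
  · filter_upwards [eventually_gt_atTop (hexConnectiveConstant ^ 4)] with y hy using sixth_order_lower hy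
  · filter_upwards [eventually_ge_atTop (36 : ℝ)] with y hy using pow_five_mul_wallRate_sq_sub_le hy

/-- ★★★ The same in Landau form: `β(y)² − (y + 1/y + 1/y² + 2/y³ + 4/y⁴ + 6/y⁵) = o(y⁻⁵)` as `y → ∞`.
[cite: BeatonBousquetMelouDeGierDuminilCopinGuttmann2014, Section 3.1, Proposition 5 (arXiv v5 p. 9)] -/
theorem isLittleO_wallRate_sq_sub_sixth :
    (fun y : ℝ => wallRate y ^ 2 - (y + 1 / y + 1 / y ^ 2 + 2 / y ^ 3 + 4 / y ^ 4 + 6 / y ^ 5)) =o[atTop] fun y : ℝ => 1 / y ^ 5 := by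
  have h0 : Tendsto (fun y : ℝ => y ^ 5 * (wallRate y ^ 2 - y - 1 / y - 1 / y ^ 2 - 2 / y ^ 3 - 4 / y ^ 4) - 6) atTop (𝓝 0) := by
    simpa using tendsto_pow_five_mul_wallRate_sq_sub.sub_const 6
  have h1 : (fun y : ℝ => y ^ 5 * (wallRate y ^ 2 - y - 1 / y - 1 / y ^ 2 - 2 / y ^ 3 - 4 / y ^ 4) - 6) =o[atTop]
      fun _ : ℝ => (1 : ℝ) := (isLittleO_one_iff ℝ).2 h0
  have h2 := h1.mul_isBigO (isBigO_refl (fun y : ℝ => 1 / y ^ 5) atTop)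
  refine (h2.congr' ?_ ?_)
  · filter_upwards [eventually_gt_atTop (0 : ℝ)] with y hy
    field_simp
    ring
  · exact Eventually.of_forall fun y => by simp

/-- ★★ Two-sided eventual form: for every `δ > 0`, eventually
`y + 1/y + 1/y² + 2/y³ + 4/y⁴ + (6 − δ)/y⁵ ≤ β(y)² ≤ y + 1/y + 1/y² + 2/y³ + 4/y⁴ + (6 + δ)/y⁵`.
[cite: BeatonBousquetMelouDeGierDuminilCopinGuttmann2014, Section 3.1, Proposition 5 (arXiv v5 p. 9)] -/
theorem eventually_sixth_order_window {δ : ℝ} (hδ : 0 < δ) :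
    ∀ᶠ y : ℝ in atTop, y + 1 / y + 1 / y ^ 2 + 2 / y ^ 3 + 4 / y ^ 4 + (6 - δ) / y ^ 5 ≤ wallRate y ^ 2 ∧
      wallRate y ^ 2 ≤ y + 1 / y + 1 / y ^ 2 + 2 / y ^ 3 + 4 / y ^ 4 + (6 + δ) / y ^ 5 := by
  have h := tendsto_pow_five_mul_wallRate_sq_sub
  have hlo := h.eventually (eventually_gt_nhds (show (6 : ℝ) - δ < 6 by linarith))
  have hhi := h.eventually (eventually_lt_nhds (show (6 : ℝ) < 6 + δ by linarith))
  filter_upwards [hlo, hhi, eventually_gt_atTop (0 : ℝ)] with y h1 h2 hy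
  have hy5 : 0 < y ^ 5 := pow_pos hy 5
  constructor
  · have e : y + 1 / y + 1 / y ^ 2 + 2 / y ^ 3 + 4 / y ^ 4 + (6 - δ) / y ^ 5 =
        (y + 1 / y + 1 / y ^ 2 + 2 / y ^ 3 + 4 / y ^ 4) + (6 - δ) / y ^ 5 := by ring
    have e2 : wallRate y ^ 2 = (y + 1 / y + 1 / y ^ 2 + 2 / y ^ 3 + 4 / y ^ 4) +
        (y ^ 5 * (wallRate y ^ 2 - y - 1 / y - 1 / y ^ 2 - 2 / y ^ 3 - 4 / y ^ 4)) / y ^ 5 := by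
      field_simp
      ring
    rw [e, e2]
    gcongr
  · have e2 : wallRate y ^ 2 = (y + 1 / y + 1 / y ^ 2 + 2 / y ^ 3 + 4 / y ^ 4) +
        (y ^ 5 * (wallRate y ^ 2 - y - 1 / y - 1 / y ^ 2 - 2 / y ^ 3 - 4 / y ^ 4)) / y ^ 5 := by
      field_simp
      ring
    have e : y + 1 / y + 1 / y ^ 2 + 2 / y ^ 3 + 4 / y ^ 4 + (6 + δ) / y ^ 5 =
        (y + 1 / y + 1 / y ^ 2 + 2 / y ^ 3 + 4 / y ^ 4) + (6 + δ) / y ^ 5 := by ring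
    rw [e, e2]
    gcongr

end Literature.Probability.RandomPlanarGeometry.SAW.HexBW.Wall
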